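import Literature.NumberTheory.NumberFields.IdeleClassFieldCharacterSeparation
import HarnessLib

/-!
# An idèle killed by every FAITHFUL class-field character of exponent `n` unramified outside `S`
# lies in `Kˣ · U_K^S · 𝕀_Kⁿ` (reduction to cyclic class fields, Tate VII §5.1 (C))

Sequel of `IdeleClassFieldCharacterSeparation.lean`: the separation theorem
`exists_eq_principalIdele_mul_mul_pow_of_forall_character` asks its hypothesis for every finite abelian
`L ⊆ K̄` and every character `χ` of `Gal(L/K)` with `χⁿ = 1` unramified outside `S`.  Here the hypothesis
is only required for FAITHFUL `χ` (injective on `Gal(L/K)`; then `Gal(L/K) ↪ μₙ(ℂ)` is cyclic of order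
dividing `n` and `L` is the class field CUT OUT by `χ`): a general `χ` factors as `χ' ∘ π` through the
restriction `π : Gal(L/K) ↠ Gal(L^{ker χ}/K)` to the fixed field of its kernel, with `χ'` faithful, and the
Artin maps are compatible in the tower `K ⊆ L^{ker χ} ⊆ L` (`artinIdeleMap_compatible`, Tate VII §5.1 (C)).

* `exists_eq_principalIdele_mul_mul_pow_of_forall_faithful_character` — the separation theorem with the
  hypothesis restricted to faithful characters.

This is the form consumed by the `μₙ`-case of Poitou–Tate (`Ker γ¹ ⊆ Im β¹`, Milne *ADT* I 4.10(b)): a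
faithful `χ` of exponent `n` is, after a choice of a primitive root of unity, a surjective cyclic character
`ψ : Γ_K ↠ ℤ/d` (`d ∣ n`) with `ker ψ = Gal(K̄/L)` — the shape of the tree's `CyclicCharacter` and of
`localInvariantMap_localization_cupProduct_δ₀_eq_neg_apply`.  Proof file: theorems only (no definition,
no named fact, no instance; D-0026).  HONEST FRAMING: textbook; proves no case of BSD (cell
bsd-schneider-ideate, crux `AnticycControlAdditiveK`, FINDING door-c6 g6 §4 node N2).

## References

* J. Tate, *Global class field theory*, Ch. VII of Cassels–Fröhlich (1967), §5.1 Main Theorem (B), (C), (D).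
  [CasselsFrohlichANT1967]
* J. Neukirch, *Algebraic Number Theory* (1999), Ch. VI Thm. (6.1). [NeukirchANT1999]
-/

noncomputable section

open Function NumberField IsDedekindDomain Field
open scoped NumberField

namespace Literature.NumberTheory.NumberFields

open Literature.NumberTheory.GaloisRepresentations

variable {K : Type} [Field K] [NumberField K]

/-! ### §1. The fixed field of the kernel of a character -/

section FixedField

variable (L : IntermediateField K (AlgebraicClosure K)) [FiniteDimensional K L] [IsAbelianGalois K L]
  [NumberField L]

omit [NumberField K] [IsAbelianGalois K L] [NumberField L] in
/-- `L^H ⊆ K̄` is finite over `K`. [folklore] -/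
private theorem finiteDimensional_lift_fixedField' (H : Subgroup (L ≃ₐ[K] L)) :
    FiniteDimensional K (IntermediateField.lift (IntermediateField.fixedField H) :
      IntermediateField K (AlgebraicClosure K)) :=
  LinearEquiv.finiteDimensional
    (IntermediateField.liftAlgEquiv (IntermediateField.fixedField H)).toLinearEquiv

omit [NumberField K] [FiniteDimensional K L] [NumberField L] in
/-- `L^H ⊆ K̄` is abelian over `K` (a subextension of an abelian extension). [folklore] -/
private theorem isAbelianGalois_lift_fixedField' (H : Subgroup (L ≃ₐ[K] L)) :
    IsAbelianGalois K (IntermediateField.lift (IntermediateField.fixedField H) :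
      IntermediateField K (AlgebraicClosure K)) :=
  IsAbelianGalois.of_algHom (IntermediateField.inclusion (IntermediateField.lift_le _))

omit [NumberField K] [IsAbelianGalois K L] [NumberField L] in
/-- **Galois correspondence read on `Γ_K`**: for `H ≤ Gal(L/K)` and `γ ∈ Γ_K`, `γ|_{L^H} = 1 ↔ γ|_L ∈ H`
(Mathlib `IntermediateField.fixingSubgroup_fixedField`; the tree's private
`absRestrictNormalHom_lift_fixedField_eq_one_iff` of `ArtinMapDecompositionInertia.lean`, restated).
[folklore] -/
private theorem absRestrictNormalHom_lift_fixedField_eq_one_iff' [IsGalois K L] (H : Subgroup (L ≃ₐ[K] L))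
    [Normal K (IntermediateField.lift (IntermediateField.fixedField H) :
      IntermediateField K (AlgebraicClosure K))]
    (γ : absoluteGaloisGroup K) :
    absRestrictNormalHom (IntermediateField.lift (IntermediateField.fixedField H)) γ = 1 ↔
      absRestrictNormalHom L γ ∈ H := by
  rw [absRestrictNormalHom_eq_one_iff, IntermediateField.mem_fixingSubgroup_iff]
  have hH : absRestrictNormalHom L γ ∈ H ↔
      ∀ y ∈ IntermediateField.fixedField H, absRestrictNormalHom L γ y = y := by
    rw [← IntermediateField.mem_fixingSubgroup_iff, IntermediateField.fixingSubgroup_fixedField]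
  rw [hH]
  have hr : ∀ y : L, ((absRestrictNormalHom L γ y : L) : AlgebraicClosure K) =
      γ • (y : AlgebraicClosure K) := fun y => AlgEquiv.restrictNormalHom_apply L _ y
  constructor
  · intro h y hy
    apply Subtype.ext
    rw [hr y, absoluteGaloisGroup.smul_def]
    exact h (y : AlgebraicClosure K) ((IntermediateField.mem_lift y).mpr hy)
  · intro h x hx
    obtain ⟨y, hy, rfl⟩ := hx
    have h2 := congrArg (fun z : L => (z : AlgebraicClosure K)) (h y hy)
    simp only [hr y, absoluteGaloisGroup.smul_def] at h2
    exact h2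

/-- **A character factors through a FAITHFUL character of the Galois group of the fixed field of its
kernel, compatibly with the Artin maps**: for a character `χ` of `Gal(L/K)` there are the finite abelian
`L' = L^{ker χ} ⊆ K̄`, the restriction `π : Gal(L/K) ↠ Gal(L'/K)` with `π ∘ r_L = r_{L'}`, and an
injective `χ' : Gal(L'/K) →* ℂˣ` with `χ = χ' ∘ π` and `π ∘ ψ_{L|K} = ψ_{L'|K}` (Tate VII §5.1 (C)).
[cite: CasselsFrohlichANT1967, Ch. VII §5.1 Main Theorem (C) and 5.3] -/
theorem exists_faithful_character_factor (χ : (L ≃ₐ[K] L) →* ℂˣ) :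
    ∃ (L' : IntermediateField K (AlgebraicClosure K)) (_ : FiniteDimensional K L') (_ : IsAbelianGalois K L')
      (_ : NumberField L') (π : (L ≃ₐ[K] L) →* (L' ≃ₐ[K] L')) (χ' : (L' ≃ₐ[K] L') →* ℂˣ),
      Injective χ' ∧ (∀ g, χ' (π g) = χ g) ∧
      (∀ γ : absoluteGaloisGroup K, π (absRestrictNormalHom L γ) = absRestrictNormalHom L' γ) ∧
      ∀ x : ideleGroup K, π (artinIdeleMap L artinReciprocity_character_holds x) =
        artinIdeleMap L' artinReciprocity_character_holds x := by
  set H : Subgroup (L ≃ₐ[K] L) := χ.ker with hH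
  set L' : IntermediateField K (AlgebraicClosure K) :=
    IntermediateField.lift (IntermediateField.fixedField H) with hL'
  haveI hfd : FiniteDimensional K L' := finiteDimensional_lift_fixedField' L H
  haveI hab : IsAbelianGalois K L' := isAbelianGalois_lift_fixedField' L H
  haveI hnf : NumberField L' := NumberField.of_module_finite K L'
  have hle : L' ≤ L := IntermediateField.lift_le _
  obtain ⟨π, hπ⟩ := exists_comp_absRestrictNormalHom_eq L' hle
  -- `ker π = H`
  have hkerπ : ∀ g, π g = 1 ↔ g ∈ H := by
    intro g
    obtain ⟨γ, rfl⟩ := absRestrictNormalHom_surjective L g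
    rw [hπ γ]
    exact absRestrictNormalHom_lift_fixedField_eq_one_iff' L H γ
  have hπsurj : Surjective π := by
    intro h
    obtain ⟨γ, rfl⟩ := absRestrictNormalHom_surjective L' h
    exact ⟨absRestrictNormalHom L γ, hπ γ⟩
  have hkerle : π.ker ≤ χ.ker := fun g hg => by
    rw [MonoidHom.mem_ker] at hg
    exact (hkerπ g).mp hg
  set χ' : (L' ≃ₐ[K] L') →* ℂˣ := π.liftOfSurjective hπsurj ⟨χ, hkerle⟩ with hχ'
  have hχ'π : ∀ g, χ' (π g) = χ g := fun g => π.liftOfRightInverse_comp_apply _ _ _ g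
  refine ⟨L', hfd, hab, hnf, π, χ', fun h₁ h₂ h12 => ?_, hχ'π, hπ, fun x =>
    artinIdeleMap_compatible L' artinReciprocity_character_holds π hπ x⟩
  -- injectivity of `χ'`
  obtain ⟨g₁, rfl⟩ := hπsurj h₁
  obtain ⟨g₂, rfl⟩ := hπsurj h₂
  rw [hχ'π, hχ'π] at h12
  have hmem : g₁ * g₂⁻¹ ∈ H := by
    rw [hH, MonoidHom.mem_ker, map_mul, map_inv, h12, mul_inv_cancel]
  have h1 : π (g₁ * g₂⁻¹) = 1 := (hkerπ _).mpr hmem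
  rwa [map_mul, map_inv, mul_inv_eq_one] at h1

end FixedField

/-! ### §2. The separation theorem with faithful characters only -/

section Separation

/-- **An idèle killed by every FAITHFUL class-field character of exponent `n` unramified outside `S`
lies in `Kˣ · U_K^S · 𝕀_Kⁿ`**: `exists_eq_principalIdele_mul_mul_pow_of_forall_character` with its
hypothesis restricted to injective `χ : Gal(L/K) →* ℂˣ` (so `L/K` cyclic of degree dividing `n`, cut
out by `χ`) — every character factors through such a one (`exists_faithful_character_factor`).
[cite: CasselsFrohlichANT1967, Ch. VII §5.1 Main Theorem (B), (C), (D)] [cite: NeukirchANT1999, Ch. VI Thm. (6.1)] -/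
theorem exists_eq_principalIdele_mul_mul_pow_of_forall_faithful_character {n : ℕ} [NeZero n]
    (S : Finset (HeightOneSpectrum (𝓞 K))) (ξ : ideleGroup K)
    (hξ : ∀ (L : IntermediateField K (AlgebraicClosure K)) [FiniteDimensional K L] [IsAbelianGalois K L]
      [NumberField L] (χ : (L ≃ₐ[K] L) →* ℂˣ), Injective χ → (∀ g, χ g ^ n = 1) →
      (∀ w : HeightOneSpectrum (𝓞 K), w ∉ S → ∀ u : (w.adicCompletion K)ˣ,
        Valued.v (u : w.adicCompletion K) = 1 →
        χ (artinIdeleMap L artinReciprocity_character_holds (localUnits w u)) = 1) →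
      χ (artinIdeleMap L artinReciprocity_character_holds ξ) = 1) :
    ∃ (a : Kˣ) (u : ideleGroup K) (y : ideleGroup K), u ∈ unitIdelesOutside K S ∧
      ξ = principalIdele K a * u * y ^ n := by
  refine exists_eq_principalIdele_mul_mul_pow_of_forall_character S ξ fun L _ _ _ χ hχn hunr => ?_
  obtain ⟨L', hfd, hab, hnf, π, χ', hinj, hχ'π, -, hAπ⟩ := exists_faithful_character_factor L χ
  haveI := hfd; haveI := hab; haveI := hnf
  have hsurjval : ∀ h : L' ≃ₐ[K] L', ∃ g, π g = h := fun h => by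
    obtain ⟨x, rfl⟩ := artinIdeleMap_surjective L' artinReciprocity_character_holds h
    exact ⟨artinIdeleMap L artinReciprocity_character_holds x, hAπ x⟩
  have hχ'n : ∀ h, χ' h ^ n = 1 := fun h => by
    obtain ⟨g, rfl⟩ := hsurjval h
    rw [hχ'π]; exact hχn g
  have hunr' : ∀ w : HeightOneSpectrum (𝓞 K), w ∉ S → ∀ u : (w.adicCompletion K)ˣ,
      Valued.v (u : w.adicCompletion K) = 1 →
      χ' (artinIdeleMap L' artinReciprocity_character_holds (localUnits w u)) = 1 := fun w hw u hu => by
    rw [← hAπ, hχ'π]; exact hunr w hw u hu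
  have h := hξ L' χ' hinj hχ'n hunr'
  rwa [← hAπ, hχ'π] at h

end Separation

end Literature.NumberTheory.NumberFields

end
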